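import Summits.Ventures.PercRepro.RankLevelSetRuleQCellThreeBinom
import Summits.Ventures.PercRepro.RankLevelSetRuleQSliceOne

/-!
# PercRepro — (R̂) ON EVERY CELL `(q+3, q)`, A SECOND DERIVATION: THE ONE-INEQUALITY (POLYNOMIAL) ROUTE
(night-1, gen 16; dossier §27)

The theorem `RhatCell q 3` for every `q ≥ 1` — Rule Q pays `Φ(q+3, q)` to every member and the UP-Hall form of C-044 holds
at the tight layer `#E = (q+3) + q` of every finite matroid — is of record as p4's `rhatCell_three` / `ruleQUp_three` /
`hallUp_three` (RankLevelSetRuleQCellThree, row identities with a sign split). This module is an INDEPENDENT second proof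
of the same statement, `rhatCell_three_poly`, by a different route and without importing the first: for `u = q − m ≥ 2`
both `j = 1, 2` are untruncated, `R̂(q, 3, m) = (u+3)·S₁ + C(u+3, 2)·S₂`, `Φ(q+3, q) = 2(q+3)/(q+1)`; then ONE inequality
covers every cell `2 ≤ m ≤ q − 2` (RankLevelSetRuleQCellThreeBinom): `S₁` in closed form with the two-term geometric tail
on `P = Σ_{i<m} C(q+m, i)` (`cellThree_S1_lower`), `S₂` by its first four terms (`cellThree_S2_lower`), and the rational
inequality `cellThree_poly` (degree 7 in `s = m − 2`, `t = q − m − 2`, one negative coefficient absorbed by a square) — no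
regime split. The ends `m ∈ {0, 1, q−1, q}` are the landed `rhat_zero_eq`, `rhatCell_one`, `rhatCell_pred`, `rhatCell_self`.
* `phiK_three'` / `mhat_three'` — `Φ(q+3, q)` and the untruncated `m̂` at `j = 2` (restated here so that the derivation
  stands on its own; the same facts are p4's `phiK_three` / `mhat_three_two`);
* **`rhatCell_three_mid`** — the cell for `2 ≤ m ≤ q − 2`; **`rhatCell_three_poly`** — `RhatCell q 3` for every `q ≥ 1`.
Consequences: with RankLevelSetRuleQCell's `ruleQUp_of_ncard_eq_of_rhatCell` / `hallUp_of_ncard_eq_of_rhatCell` this gives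
p4's `ruleQUp_three` / `hallUp_three` a second proof (not re-declared). Twin: mining/night-1/g16/k3combo2.py (exact: the one
inequality on every cell `q ≤ 400`, 0 failures), k3crude.py (the crude tail fails from `q = 17`). Axioms: standard.
-/

namespace PercRepro

open Finset

/-! ### §1 `m̂` untruncated at `j = 2`, `Φ(q+3, q)` -/

/-- On the cell `(q+3, q)` with `m ≤ q − 2`: `m̂(q, m; a, 2) = C(q+2+a, a+2)` (Vandermonde in Pascal form). -/
lemma mhat_three' (m v a : ℕ) : mhat (m + v + 2) m a 2 = (m + v + 2 + 2 + a).choose (a + 2) := by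
  rw [mhat_eq, show m + v + 2 - m = v + 2 by omega, show min 2 (v + 2) = 2 by omega]
  simp only [Finset.sum_range_succ, Finset.sum_range_zero, Nat.choose_zero_right, Nat.choose_one_right,
    Nat.choose_self, add_zero, zero_add, one_mul]
  rw [show m + v + 2 + 2 + a = m + v + 2 + a + 1 + 1 by ring, Nat.choose_succ_succ (m + v + 2 + a + 1) (a + 1),
    Nat.choose_succ_succ (m + v + 2 + a) a, Nat.choose_succ_succ (m + v + 2 + a) (a + 1)]
  ring

/-- `Φ(q+3, q) = 2(q+3)/(q+1)`. -/
lemma phiK_three' (q : ℕ) : phiK (q + 3) q = 2 * (q + 3 : ℚ) / (q + 1) := by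
  rw [phiK_eq_sum_range q 3 (by omega)]
  simp only [show (3 : ℕ) - 1 = 2 by rfl, Finset.sum_range_succ, Finset.sum_range_zero, zero_add,
    Nat.choose_one_right, add_zero]
  have h1 : (q + 0 + 1).choose q = q + 1 := by
    rw [show q + 0 + 1 = q + 1 by ring, Nat.choose_symm_add, Nat.choose_one_right]
  have h2 : (q + 1 + 1).choose q = (q + 2).choose 2 := by
    rw [show q + 1 + 1 = q + 2 by ring, Nat.choose_symm_add]
  have h3 : ((q + 2).choose 2 : ℚ) * (q + 3) = ((q + 3).choose 2 : ℚ) * (q + 1) := by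
    have h := Nat.choose_mul_succ_eq (q + 2) 2
    rw [show q + 2 + 1 - 2 = q + 1 by omega] at h
    exact_mod_cast h
  have hpos : (0 : ℚ) < (q + 2).choose 2 := by exact_mod_cast Nat.choose_pos (by omega)
  rw [h1, h2]
  push_cast
  rw [div_add_div _ _ (by positivity) hpos.ne', div_eq_div_iff (by positivity) (by positivity)]
  linear_combination (-(q + 1 : ℚ)) * h3


/-! ### §2 The explicit lower bounds -/

/-- **`S₁` from below, explicitly** (`m = s + 2`, `q = s + t + 4`, `v = t + 1`): the closed form with the two-term tail bound. -/
lemma cellThree_S1_lower (s t : ℕ) :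
    (((s : ℚ) + 2) + 1
        - ((t : ℚ) + 1) * (((s : ℚ) + 2) / ((s : ℚ) + t + 4 + 1)
            + ((s : ℚ) + 2) * ((s : ℚ) + 1) * ((s : ℚ) + t + 4 + 3)
              / (((s : ℚ) + t + 4 + 1) * ((s : ℚ) + t + 4 + 2) * ((t : ℚ) + 7))))
        / ((s : ℚ) + t + 4 + (s + 2) + 1)
      ≤ ∑ a ∈ range (s + 2 + 1), ((s + 2).choose a : ℚ) / ((s + 2 + (t + 1) + 1 + 1 + a).choose (a + 1) : ℚ) := by
  rw [cellTwo_sum_eq (s + 2) (t + 1)]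
  have hP := sum_range_choose_le_two s (t + 1)
  obtain ⟨hr1, hr2⟩ := choose_pred_ratios s (t + 1)
  push_cast at hP hr1 hr2 ⊢
  set C := ((s + 2 + (t + 1) + 1 + (s + 2)).choose (s + 2) : ℚ) with hC
  set C₁ := ((s + 2 + (t + 1) + 1 + (s + 2)).choose (s + 1) : ℚ) with hC₁
  set C₀ := ((s + 2 + (t + 1) + 1 + (s + 2)).choose s : ℚ) with hC₀
  set P := ∑ i ∈ range (s + 2), ((s + 2 + (t + 1) + 1 + (s + 2)).choose i : ℚ) with hPdef
  have hCpos : (0 : ℚ) < C := by rw [hC]; exact_mod_cast Nat.choose_pos (by omega)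
  have e1 : C₁ = C * ((s : ℚ) + 2) / ((s : ℚ) + t + 4 + 1) := by
    rw [eq_div_iff (by positivity)]; linear_combination hr1
  have e0 : C₀ = C₁ * ((s : ℚ) + 1) / ((s : ℚ) + t + 4 + 2) := by
    rw [eq_div_iff (by positivity)]; linear_combination hr2
  set R := ((s : ℚ) + 2) / ((s : ℚ) + t + 4 + 1)
      + ((s : ℚ) + 2) * ((s : ℚ) + 1) * ((s : ℚ) + t + 4 + 3)
        / (((s : ℚ) + t + 4 + 1) * ((s : ℚ) + t + 4 + 2) * ((t : ℚ) + 7)) with hR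
  have hPhi : P ≤ C * R := by
    refine hP.trans (le_of_eq ?_)
    rw [hR, e0, e1]
    field_simp
    ring
  have h1 : ((t : ℚ) + 1) * P ≤ ((t : ℚ) + 1) * (C * R) := mul_le_mul_of_nonneg_left hPhi (by positivity)
  rw [show ((s : ℚ) + 2 + ((t : ℚ) + 1) + 1 + ((s : ℚ) + 2) + 1) = (s : ℚ) + t + 4 + (s + 2) + 1 by ring]
  set D := (s : ℚ) + t + 4 + (s + 2) + 1 with hD
  have hDpos : (0 : ℚ) < D := by rw [hD]; positivity
  rw [div_le_div_iff₀ hDpos (by positivity)]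
  calc ((s : ℚ) + 2 + 1 - ((t : ℚ) + 1) * R) * (C * D)
      = (((s : ℚ) + 2 + 1) * C - ((t : ℚ) + 1) * (C * R)) * D := by ring
    _ ≤ (((s : ℚ) + 2 + 1) * C - ((t : ℚ) + 1) * P) * D := by
        apply mul_le_mul_of_nonneg_right _ hDpos.le
        linarith [h1]

/-- **`S₂` from below, explicitly**: its first four terms (`m = s + 2`, `q = s + t + 4`). -/
lemma cellThree_S2_lower (s t : ℕ) :
    2 / (((s : ℚ) + t + 4 + 2) * ((s : ℚ) + t + 4 + 1))
      + 6 * ((s : ℚ) + 2) / (((s : ℚ) + t + 4 + 3) * ((s : ℚ) + t + 4 + 2) * ((s : ℚ) + t + 4 + 1))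
      + 12 * ((s : ℚ) + 2) * ((s : ℚ) + 1)
        / (((s : ℚ) + t + 4 + 4) * ((s : ℚ) + t + 4 + 3) * ((s : ℚ) + t + 4 + 2) * ((s : ℚ) + t + 4 + 1))
      + 20 * ((s : ℚ) + 2) * ((s : ℚ) + 1) * s
        / (((s : ℚ) + t + 4 + 5) * ((s : ℚ) + t + 4 + 4) * ((s : ℚ) + t + 4 + 3) * ((s : ℚ) + t + 4 + 2)
            * ((s : ℚ) + t + 4 + 1))
      ≤ ∑ a ∈ range (s + 2 + 1), ((s + 2).choose a : ℚ) / ((s + 2 + (t + 1) + 1 + 2 + a).choose (a + 2) : ℚ) := by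
  refine le_trans ?_ (cellThree_S2_trunc (s + 2 + (t + 1) + 1) (s + 2) (by omega))
  simp only [Finset.sum_range_succ, Finset.sum_range_zero, zero_add, add_zero, Nat.choose_zero_right,
    Nat.choose_one_right, Nat.cast_one, show (1 : ℕ) + 2 = 3 by rfl, show (2 : ℕ) + 2 = 4 by rfl,
    show (3 : ℕ) + 2 = 5 by rfl]
  obtain ⟨c2, c3, c4, c5⟩ := choose_small_values (s + 2 + (t + 1) + 1)
  obtain ⟨d2, d3⟩ := choose_two_three_values s
  have e2 : (((s + 2 + (t + 1) + 1 + 2).choose 2 : ℕ) : ℚ)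
      = ((s : ℚ) + 2 + (t + 1) + 1 + 2) * ((s : ℚ) + 2 + (t + 1) + 1 + 1) / 2 := by
    rw [eq_div_iff (by norm_num)]; exact_mod_cast c2
  have e3 : (((s + 2 + (t + 1) + 1 + 2 + 1).choose 3 : ℕ) : ℚ)
      = ((s : ℚ) + 2 + (t + 1) + 1 + 3) * ((s : ℚ) + 2 + (t + 1) + 1 + 2) * ((s : ℚ) + 2 + (t + 1) + 1 + 1) / 6 := by
    rw [eq_div_iff (by norm_num)]; exact_mod_cast c3
  have e4 : (((s + 2 + (t + 1) + 1 + 2 + 2).choose 4 : ℕ) : ℚ)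
      = ((s : ℚ) + 2 + (t + 1) + 1 + 4) * ((s : ℚ) + 2 + (t + 1) + 1 + 3) * ((s : ℚ) + 2 + (t + 1) + 1 + 2)
        * ((s : ℚ) + 2 + (t + 1) + 1 + 1) / 24 := by
    rw [eq_div_iff (by norm_num)]; exact_mod_cast c4
  have e5 : (((s + 2 + (t + 1) + 1 + 2 + 3).choose 5 : ℕ) : ℚ)
      = ((s : ℚ) + 2 + (t + 1) + 1 + 5) * ((s : ℚ) + 2 + (t + 1) + 1 + 4) * ((s : ℚ) + 2 + (t + 1) + 1 + 3)
        * ((s : ℚ) + 2 + (t + 1) + 1 + 2) * ((s : ℚ) + 2 + (t + 1) + 1 + 1) / 120 := by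
    rw [eq_div_iff (by norm_num)]; exact_mod_cast c5
  have f2 : (((s + 2).choose 2 : ℕ) : ℚ) = ((s : ℚ) + 2) * ((s : ℚ) + 1) / 2 := by
    rw [eq_div_iff (by norm_num)]; exact d2
  have f3 : (((s + 2).choose 3 : ℕ) : ℚ) = ((s : ℚ) + 2) * ((s : ℚ) + 1) * s / 6 := by
    rw [eq_div_iff (by norm_num)]; exact d3
  rw [e2, e3, e4, e5, f2, f3]
  push_cast
  apply le_of_eq
  field_simp
  ring

/-! ### §3 The cell `(q+3, q)` -/

/-- **(R̂) on the cell `(q+3, q)` for `2 ≤ m ≤ q − 2`** (`m = s + 2`, `q = m + v + 1`, `v = t + 1`): the one inequality. -/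
theorem rhatCell_three_mid (s t : ℕ) :
    phiK (s + 2 + (t + 1) + 1 + 3) (s + 2 + (t + 1) + 1) ≤ rhat (s + 2 + (t + 1) + 1) 3 (s + 2) := by
  rw [phiK_three']
  unfold rhat
  rw [sum_Ioo_nat, show (3 : ℕ) - (0 + 1) = 1 + 1 by rfl, Finset.sum_range_succ _ 1, Finset.sum_range_one]
  simp only [zero_add, add_zero, show (1 : ℕ) + 1 = 2 by rfl,
    show s + 2 + (t + 1) + 1 + 3 - (s + 2) = t + 5 by omega]
  simp only [Nat.choose_one_right]
  have hm1 : ∀ a, mhat (s + 2 + (t + 1) + 1) (s + 2) a 1 = (s + 2 + (t + 1) + 1 + 1 + a).choose (a + 1) :=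
    fun a => mhat_two (s + 2) (t + 1) a
  have hm2 : ∀ a, mhat (s + 2 + (t + 1) + 1) (s + 2) a 2 = (s + 2 + (t + 1) + 1 + 2 + a).choose (a + 2) := by
    intro a
    rw [show s + 2 + (t + 1) + 1 = s + 2 + t + 2 by ring, mhat_three']
  simp only [hm1, hm2]
  push_cast
  have hrw1 : ∑ a ∈ range (s + 2 + 1), ((s + 2).choose a : ℚ) * ((t : ℚ) + 5)
        / ((s + 2 + (t + 1) + 1 + 1 + a).choose (a + 1) : ℚ)
      = ((t : ℚ) + 5) * ∑ a ∈ range (s + 2 + 1), ((s + 2).choose a : ℚ)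
        / ((s + 2 + (t + 1) + 1 + 1 + a).choose (a + 1) : ℚ) := by
    rw [Finset.mul_sum]; exact Finset.sum_congr rfl (fun a _ => by ring)
  have hrw2 : ∑ a ∈ range (s + 2 + 1), ((s + 2).choose a : ℚ) * ((t + 5).choose 2 : ℚ)
        / ((s + 2 + (t + 1) + 1 + 2 + a).choose (a + 2) : ℚ)
      = ((t + 5).choose 2 : ℚ) * ∑ a ∈ range (s + 2 + 1), ((s + 2).choose a : ℚ)
        / ((s + 2 + (t + 1) + 1 + 2 + a).choose (a + 2) : ℚ) := by
    rw [Finset.mul_sum]; exact Finset.sum_congr rfl (fun a _ => by ring)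
  have hc : ((t + 5).choose 2 : ℚ) = ((t : ℚ) + 5) * ((t : ℚ) + 4) / 2 := by
    have h := Nat.add_one_mul_choose_eq (t + 4) 1
    rw [Nat.choose_one_right] at h
    rw [eq_div_iff (by norm_num)]
    exact_mod_cast h.symm
  have hL : 2 * ((s : ℚ) + 2 + ((t : ℚ) + 1) + 1 + 3) / ((s : ℚ) + 2 + ((t : ℚ) + 1) + 1 + 1)
      = 2 * ((s : ℚ) + t + 4 + 3) / ((s : ℚ) + t + 4 + 1) := by ring
  rw [hrw1, hrw2, hc, hL]
  refine (cellThree_poly s t).trans ?_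
  have h5 : (0 : ℚ) ≤ (t : ℚ) + 5 := by positivity
  have h54 : (0 : ℚ) ≤ ((t : ℚ) + 5) * ((t : ℚ) + 4) / 2 := by positivity
  exact add_le_add (mul_le_mul_of_nonneg_left (cellThree_S1_lower s t) h5)
    (mul_le_mul_of_nonneg_left (cellThree_S2_lower s t) h54)

/-- **(R̂) on the whole cell `(q+3, q)`, second derivation**: `RhatCell q 3` for every `q ≥ 1` — the ends `m ∈ {0, 1, q−1, q}`
from the landed `rhat_zero_eq`, `rhatCell_one`, `rhatCell_pred`, `rhatCell_self`, the middle from `rhatCell_three_mid`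
(the statement of p4's `rhatCell_three`, proved independently). -/
theorem rhatCell_three_poly (q : ℕ) (hq : 1 ≤ q) : RhatCell q 3 := by
  intro m hm
  rcases Nat.eq_or_lt_of_le hm with rfl | hlt
  · exact rhatCell_self m 3 (by norm_num)
  rcases Nat.eq_or_lt_of_le (Nat.succ_le_of_lt hlt) with h1 | h2
  · rw [show m = q - 1 by omega]
    exact rhatCell_pred q 3 hq (by norm_num)
  rcases Nat.lt_or_ge m 2 with hm2 | hm2
  · interval_cases m
    · rw [rhat_zero_eq q 3 (by norm_num)]
    · exact rhatCell_one q 3 hq (by norm_num)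
  obtain ⟨s, rfl⟩ : ∃ s, m = s + 2 := ⟨m - 2, by omega⟩
  obtain ⟨t, rfl⟩ : ∃ t, q = s + 2 + (t + 1) + 1 := ⟨q - s - 4, by omega⟩
  exact rhatCell_three_mid s t

end PercRepro
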